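import Mathlib
import Literature.Probability.LatticeModels.ScalingLimit
import Summits.CriticalPhenomena.Ising3DConformalLimit.Theorems.PrimaryAtInfinityMultipoleToWardHelpers
import Summits.CriticalPhenomena.Ising3DConformalLimit.Theorems.PrecisionLaplacianMoebiusLimitOfTwoPointLawMultipoleToWardOfContinuousAux
import Summits.CriticalPhenomena.Ising3DConformalLimit.Theorems.PrecisionLaplacianMoebiusLimitOfTwoPointLawMultipoleToWardOfContinuousAux2
import HarnessLib

/-!
# Stub S5b `stub_multipoleToWardOfContinuous` (line `multipole-ward-nonsat-endpoint`,
crux `MoebiusLimitOfTwoPointLaw`, item stmt-CriticalPhenomena-4801)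

Item stmt-CriticalPhenomena-5356 `PrimaryAtInfinity.MultipoleToWard` with CONTINUOUS far-field
coefficients: if every `S n` is continuous off the diagonals, `c ≠ 0`, and for every `n` there are
continuous far-field coefficients `A₀, A₁` of `S (n+2)` satisfying the first-multipole identity at
level `n+1` and the monopole/dipole clustering at level `n`, then every `S n` satisfies the weak
special-conformal Ward identity with weight `Δ`.

Proof: test the level-`(n+1)` identity with `ψ_L(w) = φ(init w) χ(w last / L)` for an even annular
bump `χ` (`exists_even_annular_bump`) and `L → ∞`. By `mtw_key_identity` (part 2) the separable main
terms cancel by oddness and `c (∫χ_L) W(φ) = ∫ (⟪r₁, b⟫ φ χ_L − r₀ B_L)`; the clustering remainders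
`r₀, r₁` are uniformly small on `tsupport φ × {L ≤ ‖z‖ ≤ RL}` (`exists_radius_of_tendstoLocallyUniformlyOn`),
the bracket `B_L` is `O(L)` there while `‖z‖ |r₀| ≤ ε`, so the right-hand side is `O(ε L³)` whereas
`∫χ_L = L³ ∫χ` (`integral_comp_inv_smul_three`); hence `W(φ) = 0`.
[FrancescoMathieuSenechal1997 §4.2–4.3; HormanderALPDO1 §1]
-/

noncomputable section

namespace Summit.CriticalPhenomena.Ising3DConformalLimit.PrecisionLaplacianMoebiusLimitOfTwoPointLaw

open Literature.Probability.LatticeModels Filter Topology MeasureTheory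
open Summit.CriticalPhenomena.Ising3DConformalLimit.Theorems.PrimaryAtInfinityMultipoleToWard

/-! ## Elementary bounds -/

/-- The special-conformal vector field has quadratic growth: `‖‖z‖² b − 2⟪b,z⟫ z‖ ≤ 3 ‖b‖ ‖z‖²`. -/
theorem mtw_norm_sctField_le (b z : EuclideanSpace ℝ (Fin 3)) :
    ‖‖z‖ ^ 2 • b - (2 * inner ℝ b z) • z‖ ≤ 3 * ‖b‖ * ‖z‖ ^ 2 := by
  calc ‖‖z‖ ^ 2 • b - (2 * inner ℝ b z) • z‖
      ≤ ‖‖z‖ ^ 2 • b‖ + ‖(2 * inner ℝ b z) • z‖ := norm_sub_le _ _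
    _ = ‖z‖ ^ 2 * ‖b‖ + 2 * |inner ℝ b z| * ‖z‖ := by
        rw [norm_smul, norm_smul, Real.norm_eq_abs, Real.norm_eq_abs, abs_of_nonneg (sq_nonneg _),
          abs_mul, abs_two]
    _ ≤ ‖z‖ ^ 2 * ‖b‖ + 2 * (‖b‖ * ‖z‖) * ‖z‖ := by
        gcongr
        exact abs_real_inner_le_norm b z
    _ = 3 * ‖b‖ * ‖z‖ ^ 2 := by ring

/-- The pointwise bound on the remainder integrand `⟪r₁,b⟫ φ g − r₀ B` (pure real arithmetic):
with `|⟪r₁,b⟫| ≤ ε‖b‖`, `L|r₀| ≤ ε` and the bracket `B = a(Σ + ⟪b,z⟫)φg + (g Dφ + φ Dg)` of size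
`O(L)`, the integrand is `≤ ε · C'` with `C'` independent of `ε` and `L ≥ 1`. -/
theorem mtw_remainder_bound {ε L Mφ Mχ M₁ M₂ M₃ nb R a r₀ φx gz Dφ Dg sx ipz ip1 : ℝ}
    (hL : 1 ≤ L) (hMφ : 0 ≤ Mφ) (hMχ : 0 ≤ Mχ) (hM₁ : 0 ≤ M₁) (hM₂ : 0 ≤ M₂) (hM₃ : 0 ≤ M₃)
    (hnb : 0 ≤ nb) (hR : 0 ≤ R) (hε : 0 ≤ ε)
    (h1 : |ip1| ≤ ε * nb) (h0 : L * |r₀| ≤ ε) (hφx : |φx| ≤ Mφ) (hgz : |gz| ≤ Mχ)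
    (hsx : |sx * φx| ≤ M₃) (hip : |ipz| ≤ nb * (R * L)) (hDφ : |Dφ| ≤ M₂)
    (hDg : |Dg| ≤ 3 * M₁ * nb * R ^ 2 * L) :
    |ip1 * (φx * gz) - r₀ * (a * (sx + ipz) * (φx * gz) + (gz * Dφ + φx * Dg))| ≤
      ε * (nb * Mφ * Mχ +
        (|a| * (M₃ * Mχ + nb * R * Mφ * Mχ) + Mχ * M₂ + 3 * M₁ * nb * R ^ 2 * Mφ)) := by
  have t1 : |ip1 * (φx * gz)| ≤ ε * nb * Mφ * Mχ := by
    rw [abs_mul, abs_mul]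
    calc |ip1| * (|φx| * |gz|) ≤ (ε * nb) * (Mφ * Mχ) :=
          mul_le_mul h1 (mul_le_mul hφx hgz (abs_nonneg _) hMφ)
            (mul_nonneg (abs_nonneg _) (abs_nonneg _)) (mul_nonneg hε hnb)
      _ = ε * nb * Mφ * Mχ := by ring
  have t2 : |a * (sx + ipz) * (φx * gz)| ≤ |a| * (M₃ * Mχ + nb * (R * L) * Mφ * Mχ) := by
    have e : a * (sx + ipz) * (φx * gz) = a * ((sx * φx) * gz + ipz * (φx * gz)) := by ring
    rw [e, abs_mul]
    refine mul_le_mul_of_nonneg_left ?_ (abs_nonneg a)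
    calc |(sx * φx) * gz + ipz * (φx * gz)|
        ≤ |(sx * φx) * gz| + |ipz * (φx * gz)| := abs_add_le _ _
      _ = |sx * φx| * |gz| + |ipz| * (|φx| * |gz|) := by
          rw [abs_mul (sx * φx) gz, abs_mul ipz (φx * gz), abs_mul φx gz]
      _ ≤ M₃ * Mχ + nb * (R * L) * (Mφ * Mχ) :=
          add_le_add (mul_le_mul hsx hgz (abs_nonneg _) hM₃)
            (mul_le_mul hip (mul_le_mul hφx hgz (abs_nonneg _) hMφ)
              (mul_nonneg (abs_nonneg _) (abs_nonneg _))
              (mul_nonneg hnb (mul_nonneg hR (by linarith))))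
      _ = M₃ * Mχ + nb * (R * L) * Mφ * Mχ := by ring
  have t3 : |gz * Dφ + φx * Dg| ≤ Mχ * M₂ + Mφ * (3 * M₁ * nb * R ^ 2 * L) := by
    calc |gz * Dφ + φx * Dg| ≤ |gz * Dφ| + |φx * Dg| := abs_add_le _ _
      _ = |gz| * |Dφ| + |φx| * |Dg| := by rw [abs_mul, abs_mul]
      _ ≤ Mχ * M₂ + Mφ * (3 * M₁ * nb * R ^ 2 * L) :=
          add_le_add (mul_le_mul hgz hDφ (abs_nonneg _) hMχ)
            (mul_le_mul hφx hDg (abs_nonneg _) hMφ)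
  have tB : |a * (sx + ipz) * (φx * gz) + (gz * Dφ + φx * Dg)| ≤
      L * (|a| * (M₃ * Mχ + nb * R * Mφ * Mχ) + Mχ * M₂ + 3 * M₁ * nb * R ^ 2 * Mφ) := by
    calc |a * (sx + ipz) * (φx * gz) + (gz * Dφ + φx * Dg)|
        ≤ |a * (sx + ipz) * (φx * gz)| + |gz * Dφ + φx * Dg| := abs_add_le _ _
      _ ≤ |a| * (M₃ * Mχ + nb * (R * L) * Mφ * Mχ) + (Mχ * M₂ + Mφ * (3 * M₁ * nb * R ^ 2 * L)) :=
          add_le_add t2 t3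
      _ ≤ L * (|a| * (M₃ * Mχ + nb * R * Mφ * Mχ) + Mχ * M₂ + 3 * M₁ * nb * R ^ 2 * Mφ) := by
          have h1 : 0 ≤ (L - 1) * (|a| * (M₃ * Mχ) + Mχ * M₂) :=
            mul_nonneg (by linarith) (add_nonneg (mul_nonneg (abs_nonneg _) (mul_nonneg hM₃ hMχ))
              (mul_nonneg hMχ hM₂))
          nlinarith [h1]
  have hCb : 0 ≤ |a| * (M₃ * Mχ + nb * R * Mφ * Mχ) + Mχ * M₂ + 3 * M₁ * nb * R ^ 2 * Mφ :=
    add_nonneg (add_nonneg (mul_nonneg (abs_nonneg _) (add_nonneg (mul_nonneg hM₃ hMχ)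
      (mul_nonneg (mul_nonneg (mul_nonneg hnb hR) hMφ) hMχ))) (mul_nonneg hMχ hM₂))
      (mul_nonneg (mul_nonneg (mul_nonneg (mul_nonneg (by norm_num) hM₁) hnb) (sq_nonneg R)) hMφ)
  calc |ip1 * (φx * gz) - r₀ * (a * (sx + ipz) * (φx * gz) + (gz * Dφ + φx * Dg))|
      ≤ |ip1 * (φx * gz)| + |r₀ * (a * (sx + ipz) * (φx * gz) + (gz * Dφ + φx * Dg))| :=
        abs_sub _ _
    _ = |ip1 * (φx * gz)| + |r₀| * |a * (sx + ipz) * (φx * gz) + (gz * Dφ + φx * Dg)| := by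
        rw [abs_mul r₀]
    _ ≤ ε * nb * Mφ * Mχ +
        |r₀| * (L * (|a| * (M₃ * Mχ + nb * R * Mφ * Mχ) + Mχ * M₂ + 3 * M₁ * nb * R ^ 2 * Mφ)) :=
        add_le_add t1 (mul_le_mul_of_nonneg_left tB (abs_nonneg _))
    _ = ε * nb * Mφ * Mχ +
        (L * |r₀|) * (|a| * (M₃ * Mχ + nb * R * Mφ * Mχ) + Mχ * M₂ + 3 * M₁ * nb * R ^ 2 * Mφ) := by
        ring
    _ ≤ ε * nb * Mφ * Mχ +
        ε * (|a| * (M₃ * Mχ + nb * R * Mφ * Mχ) + Mχ * M₂ + 3 * M₁ * nb * R ^ 2 * Mφ) := by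
        gcongr
    _ = ε * (nb * Mφ * Mχ +
        (|a| * (M₃ * Mχ + nb * R * Mφ * Mχ) + Mχ * M₂ + 3 * M₁ * nb * R ^ 2 * Mφ)) := by ring


/-! ## The limiting argument -/

/-- **Engine.** From the first-multipole identity (tested against all smooth compactly supported `ψ`
off the diagonals of `(ℝ³)ⁿ⁺¹`) and uniform smallness of the clustering remainders on
`tsupport φ` beyond a radius, the weak special-conformal Ward functional `W(φ)` vanishes. -/
theorem mtw_ward_of_farField {n : ℕ} (b : EuclideanSpace ℝ (Fin 3)) (Δ c : ℝ)
    (Sn : (Fin n → EuclideanSpace ℝ (Fin 3)) → ℝ)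
    (A₀ : (Fin (n + 1) → EuclideanSpace ℝ (Fin 3)) → ℝ)
    (A₁ : (Fin (n + 1) → EuclideanSpace ℝ (Fin 3)) → EuclideanSpace ℝ (Fin 3))
    (φ : (Fin n → EuclideanSpace ℝ (Fin 3)) → ℝ) (hc : c ≠ 0)
    (hSn : ContinuousOn Sn (NonCoincident 3 n)) (hA₀ : ContinuousOn A₀ (NonCoincident 3 (n + 1)))
    (hA₁ : ContinuousOn A₁ (NonCoincident 3 (n + 1)))
    (hφ : ContDiff ℝ ((⊤ : ℕ∞) : WithTop ℕ∞) φ) (hφc : HasCompactSupport φ)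
    (hφs : tsupport φ ⊆ NonCoincident 3 n)
    (hI : ∀ ψ : (Fin (n + 1) → EuclideanSpace ℝ (Fin 3)) → ℝ,
      ContDiff ℝ ((⊤ : ℕ∞) : WithTop ℕ∞) ψ → HasCompactSupport ψ →
      tsupport ψ ⊆ NonCoincident 3 (n + 1) →
      ∫ w, inner ℝ (A₁ w) b * ψ w =
        ∫ w, A₀ w * ((2 * Δ - 6) * (∑ i, inner ℝ b (w i)) * ψ w +
          fderiv ℝ ψ w (fun i => ‖w i‖ ^ 2 • b - (2 * inner ℝ b (w i)) • w i)))
    (hMD : ∀ ε : ℝ, 0 < ε → ∃ R : ℝ, ∀ z : EuclideanSpace ℝ (Fin 3), R ≤ ‖z‖ →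
      ∀ x ∈ tsupport φ, ‖‖z‖ * (A₀ (Fin.snoc x z) - c * Sn x)‖ ≤ ε ∧
        ‖A₁ (Fin.snoc x z) - (2 * Δ * c * Sn x) • z‖ ≤ ε) :
    ∫ x, Sn x * ((2 * Δ - 6) * (∑ i, inner ℝ b (x i)) * φ x +
      fderiv ℝ φ x (fun i => ‖x i‖ ^ 2 • b - (2 * inner ℝ b (x i)) • x i)) = 0 := by
  obtain ⟨χ, hχ, hχc, hχe, hχ1, hχi⟩ := exists_even_annular_bump
  obtain ⟨Rχ, hRχ1, hRχ⟩ := mtw_tsupport_norm_bounds hχc hχ1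
  have hRχ0 : 0 < Rχ := by linarith
  obtain ⟨d, hdc, hdcs, hd0, hd1⟩ := mtw_exists_dominatingBump hRχ0
  -- uniform bounds
  have hφ0 : Continuous φ := hφ.continuous
  have hφ1 : Continuous (fderiv ℝ φ) := hφ.continuous_fderiv (by simp)
  have hχ0 : Continuous χ := hχ.continuous
  obtain ⟨Mφ, hMφ⟩ := hφ0.bounded_above_of_compact_support hφc
  obtain ⟨Mχ, hMχ⟩ := hχ0.bounded_above_of_compact_support hχc
  obtain ⟨M₁, hM₁⟩ := (hχ.continuous_fderiv (by simp)).bounded_above_of_compact_support (hχc.fderiv (𝕜 := ℝ))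
  have hK : IsCompact (tsupport φ) := hφc
  have hθ2c : Continuous fun x : Fin n → EuclideanSpace ℝ (Fin 3) =>
      fderiv ℝ φ x (fun i => ‖x i‖ ^ 2 • b - (2 * inner ℝ b (x i)) • x i) := by fun_prop
  obtain ⟨M₂, hM₂⟩ := hK.exists_bound_of_continuousOn hθ2c.continuousOn
  have hθ3c : Continuous fun x : Fin n → EuclideanSpace ℝ (Fin 3) =>
      (∑ i, inner ℝ b (x i)) * φ x := by fun_prop
  obtain ⟨M₃, hM₃⟩ := hK.exists_bound_of_continuousOn hθ3c.continuousOn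
  obtain ⟨ρ₀, hρ₀⟩ := hK.isBounded.exists_norm_le
  have hdi : Integrable d := hdc.integrable_of_hasCompactSupport hdcs
  have hdi0 : 0 ≤ ∫ z, d z := integral_nonneg hd0
  -- the constant
  have hC'0 : 0 ≤ ‖b‖ * |Mφ| * |Mχ| + (|2 * Δ - 6| * (|M₃| * |Mχ| + ‖b‖ * Rχ * |Mφ| * |Mχ|) +
      |Mχ| * |M₂| + 3 * |M₁| * ‖b‖ * Rχ ^ 2 * |Mφ|) := by positivity
  -- main estimate: for every `ε > 0`, `|c| (∫χ) |W| ≤ ε C`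
  have hmain : ∀ ε : ℝ, 0 < ε →
      |c| * (∫ z, χ z) * |∫ x, Sn x * ((2 * Δ - 6) * (∑ i, inner ℝ b (x i)) * φ x +
        fderiv ℝ φ x (fun i => ‖x i‖ ^ 2 • b - (2 * inner ℝ b (x i)) • x i))| ≤
      ε * ((‖b‖ * |Mφ| * |Mχ| + (|2 * Δ - 6| * (|M₃| * |Mχ| + ‖b‖ * Rχ * |Mφ| * |Mχ|) +
        |Mχ| * |M₂| + 3 * |M₁| * ‖b‖ * Rχ ^ 2 * |Mφ|)) *
        (volume.real (tsupport φ) * ∫ z, d z)) := by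
    intro ε hε
    obtain ⟨R, hR⟩ := hMD ε hε
    obtain ⟨L, hL1, hLR, hLρ⟩ : ∃ L : ℝ, 1 ≤ L ∧ R ≤ L ∧ ρ₀ < L :=
      ⟨max (max R 1) (ρ₀ + 1), le_trans (le_max_right _ _) (le_max_left _ _),
        le_trans (le_max_left _ _) (le_max_left _ _),
        lt_of_lt_of_le (lt_add_one _) (le_max_right _ _)⟩
    have hL0 : 0 < L := by linarith
    -- the dilated cut-off `g = χ(·/L)`
    have hgT : ∀ z ∈ tsupport (fun z : EuclideanSpace ℝ (Fin 3) => χ (L⁻¹ • z)),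
        L ≤ ‖z‖ ∧ ‖z‖ ≤ Rχ * L := by
      intro z hz
      have h1 : L⁻¹ • z ∈ tsupport χ :=
        tsupport_comp_subset_preimage χ (continuous_const_smul L⁻¹) hz
      obtain ⟨ha, hb⟩ := hRχ _ h1
      rw [norm_smul, norm_inv, Real.norm_eq_abs, abs_of_pos hL0, inv_mul_eq_div] at ha hb
      exact ⟨by rwa [le_div_iff₀ hL0, one_mul] at ha, by rwa [div_le_iff₀ hL0] at hb⟩
    have hg : ContDiff ℝ ((⊤ : ℕ∞) : WithTop ℕ∞) (fun z : EuclideanSpace ℝ (Fin 3) => χ (L⁻¹ • z)) :=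
      hχ.comp (contDiff_const_smul L⁻¹)
    have hgc : HasCompactSupport (fun z : EuclideanSpace ℝ (Fin 3) => χ (L⁻¹ • z)) := by
      refine HasCompactSupport.intro (isCompact_closedBall (0 : EuclideanSpace ℝ (Fin 3)) (Rχ * L))
        fun z hz => ?_
      have hz' : z ∉ tsupport (fun z : EuclideanSpace ℝ (Fin 3) => χ (L⁻¹ • z)) := fun h =>
        hz (Metric.mem_closedBall.2 (by rw [dist_zero_right]; exact (hgT z h).2))
      exact image_eq_zero_of_notMem_tsupport (f := fun z : EuclideanSpace ℝ (Fin 3) => χ (L⁻¹ • z)) hz'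
    have hge : ∀ z : EuclideanSpace ℝ (Fin 3), χ (L⁻¹ • -z) = χ (L⁻¹ • z) := fun z => by
      rw [smul_neg, hχe]
    have hsep : ∀ x ∈ tsupport φ, ∀ z ∈ tsupport (fun z : EuclideanSpace ℝ (Fin 3) => χ (L⁻¹ • z)),
        ∀ i, x i ≠ z := by
      intro x hx z hz i heq
      have h1 := (hgT z hz).1
      have h2 : ‖x i‖ ≤ ρ₀ := (norm_le_pi_norm x i).trans (hρ₀ x hx)
      rw [heq] at h2
      linarith
    -- admissibility of `ψ(w) = φ(init w) g(w last)` and the key identity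
    have hψ := contDiff_init_mul_last (n := n) hφ hg
    obtain ⟨hψc, hψt⟩ := mtw_hasCompactSupport_of_vanish hφc hgc
      (θ := fun w : Fin (n + 1) → EuclideanSpace ℝ (Fin 3) =>
        φ (Fin.init w) * χ (L⁻¹ • w (Fin.last n)))
      (fun w hw => by rw [image_eq_zero_of_notMem_tsupport hw, zero_mul])
      (fun w hw => by
        have h := image_eq_zero_of_notMem_tsupport hw
        beta_reduce at h
        rw [h, mul_zero])
    have hψs : tsupport (fun w : Fin (n + 1) → EuclideanSpace ℝ (Fin 3) =>
        φ (Fin.init w) * χ (L⁻¹ • w (Fin.last n))) ⊆ NonCoincident 3 (n + 1) :=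
      hψt.trans (mtw_setOf_subset_nonCoincident hφs hsep)
    have hIψ := hI _ hψ hψc hψs
    have hkey := mtw_key_identity n b Δ c Sn A₀ A₁ φ (fun z => χ (L⁻¹ • z)) hSn hA₀ hA₁ hφ hφc hφs
      hg hgc hge hsep hIψ
    rw [integral_comp_inv_smul_three χ hL0.le] at hkey
    -- pointwise bound of the remainder integrand
    have hpt : ∀ w : Fin (n + 1) → EuclideanSpace ℝ (Fin 3),
        |inner ℝ (A₁ w - (2 * Δ * c * Sn (Fin.init w)) • w (Fin.last n)) b *
              (φ (Fin.init w) * χ (L⁻¹ • w (Fin.last n))) -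
            (A₀ w - c * Sn (Fin.init w)) *
              ((2 * Δ - 6) * ((∑ i, inner ℝ b (Fin.init w i)) + inner ℝ b (w (Fin.last n))) *
                  (φ (Fin.init w) * χ (L⁻¹ • w (Fin.last n))) +
                (χ (L⁻¹ • w (Fin.last n)) * fderiv ℝ φ (Fin.init w)
                    (fun i => ‖Fin.init w i‖ ^ 2 • b - (2 * inner ℝ b (Fin.init w i)) • Fin.init w i) +
                  φ (Fin.init w) * fderiv ℝ (fun z : EuclideanSpace ℝ (Fin 3) => χ (L⁻¹ • z))
                    (w (Fin.last n)) (‖w (Fin.last n)‖ ^ 2 • b -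
                      (2 * inner ℝ b (w (Fin.last n))) • w (Fin.last n))))| ≤
        ε * (‖b‖ * |Mφ| * |Mχ| + (|2 * Δ - 6| * (|M₃| * |Mχ| + ‖b‖ * Rχ * |Mφ| * |Mχ|) +
          |Mχ| * |M₂| + 3 * |M₁| * ‖b‖ * Rχ ^ 2 * |Mφ|)) *
          ((tsupport φ).indicator (1 : (Fin n → EuclideanSpace ℝ (Fin 3)) → ℝ) (Fin.init w) *
            d (L⁻¹ • w (Fin.last n))) := by
      intro w
      by_cases hx : Fin.init w ∈ tsupport φ
      · by_cases hz : w (Fin.last n) ∈ tsupport (fun z : EuclideanSpace ℝ (Fin 3) => χ (L⁻¹ • z))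
        · obtain ⟨hzL, hzR⟩ := hgT _ hz
          have hdz : d (L⁻¹ • w (Fin.last n)) = 1 := hd1 _ (by
            rw [norm_smul, norm_inv, Real.norm_eq_abs, abs_of_pos hL0, inv_mul_le_iff₀ hL0, mul_comm]
            exact hzR)
          rw [Set.indicator_of_mem hx, Pi.one_apply, hdz, mul_one, mul_one]
          obtain ⟨h0, h1⟩ := hR (w (Fin.last n)) (hLR.trans hzL) (Fin.init w) hx
          rw [Fin.snoc_init_self] at h0 h1
          have e1 : |inner ℝ (A₁ w - (2 * Δ * c * Sn (Fin.init w)) • w (Fin.last n)) b| ≤ ε * ‖b‖ :=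
            (abs_real_inner_le_norm _ _).trans (mul_le_mul_of_nonneg_right h1 (norm_nonneg _))
          have e0 : L * |A₀ w - c * Sn (Fin.init w)| ≤ ε := by
            rw [Real.norm_eq_abs, abs_mul, abs_norm] at h0
            exact le_trans (mul_le_mul_of_nonneg_right hzL (abs_nonneg _)) h0
          have eφ : |φ (Fin.init w)| ≤ |Mφ| :=
            (Real.norm_eq_abs _ ▸ hMφ (Fin.init w)).trans (le_abs_self _)
          have eg : |χ (L⁻¹ • w (Fin.last n))| ≤ |Mχ| :=
            (Real.norm_eq_abs _ ▸ hMχ _).trans (le_abs_self _)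
          have esx : |(∑ i, inner ℝ b (Fin.init w i)) * φ (Fin.init w)| ≤ |M₃| :=
            (Real.norm_eq_abs _ ▸ hM₃ (Fin.init w) hx).trans (le_abs_self _)
          have eip : |inner ℝ b (w (Fin.last n))| ≤ ‖b‖ * (Rχ * L) :=
            (abs_real_inner_le_norm _ _).trans (mul_le_mul_of_nonneg_left hzR (norm_nonneg _))
          have eDφ : |fderiv ℝ φ (Fin.init w)
              (fun i => ‖Fin.init w i‖ ^ 2 • b - (2 * inner ℝ b (Fin.init w i)) • Fin.init w i)| ≤
              |M₂| :=
            (Real.norm_eq_abs _ ▸ hM₂ (Fin.init w) hx).trans (le_abs_self _)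
          have eDg : |fderiv ℝ (fun z : EuclideanSpace ℝ (Fin 3) => χ (L⁻¹ • z)) (w (Fin.last n))
              (‖w (Fin.last n)‖ ^ 2 • b - (2 * inner ℝ b (w (Fin.last n))) • w (Fin.last n))| ≤
              3 * |M₁| * ‖b‖ * Rχ ^ 2 * L := by
            rw [mtw_fderiv_comp_smul, ← Real.norm_eq_abs]
            calc ‖fderiv ℝ χ (L⁻¹ • w (Fin.last n)) (L⁻¹ • (‖w (Fin.last n)‖ ^ 2 • b -
                    (2 * inner ℝ b (w (Fin.last n))) • w (Fin.last n)))‖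
                ≤ ‖fderiv ℝ χ (L⁻¹ • w (Fin.last n))‖ * ‖L⁻¹ • (‖w (Fin.last n)‖ ^ 2 • b -
                    (2 * inner ℝ b (w (Fin.last n))) • w (Fin.last n))‖ :=
                  ContinuousLinearMap.le_opNorm _ _
              _ ≤ |M₁| * (L⁻¹ * (3 * ‖b‖ * ‖w (Fin.last n)‖ ^ 2)) := by
                  refine mul_le_mul ((hM₁ _).trans (le_abs_self _)) ?_ (norm_nonneg _) (abs_nonneg _)
                  rw [norm_smul, norm_inv, Real.norm_eq_abs, abs_of_pos hL0]
                  exact mul_le_mul_of_nonneg_left (mtw_norm_sctField_le b _) (inv_nonneg.2 hL0.le)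
              _ ≤ |M₁| * (L⁻¹ * (3 * ‖b‖ * (Rχ * L) ^ 2)) := by gcongr
              _ = 3 * |M₁| * ‖b‖ * Rχ ^ 2 * L := by field_simp
          exact mtw_remainder_bound hL1 (abs_nonneg Mφ) (abs_nonneg Mχ) (abs_nonneg M₁) (abs_nonneg M₂)
            (abs_nonneg M₃) (norm_nonneg b) hRχ0.le hε.le e1 e0 eφ eg esx eip eDφ eDg
        · have hg0 : χ (L⁻¹ • w (Fin.last n)) = 0 := by
            have h := image_eq_zero_of_notMem_tsupport hz
            beta_reduce at h
            exact h
          have hg0' : fderiv ℝ (fun z : EuclideanSpace ℝ (Fin 3) => χ (L⁻¹ • z)) (w (Fin.last n)) = 0 :=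
            fderiv_of_notMem_tsupport ℝ hz
          rw [hg0, hg0']
          simp only [mul_zero, zero_mul, add_zero, zero_apply, sub_zero, abs_zero]
          exact mul_nonneg (mul_nonneg hε.le hC'0)
            (mul_nonneg (Set.indicator_nonneg (fun _ _ => zero_le_one) _) (hd0 _))
      · have hφ0' : φ (Fin.init w) = 0 := image_eq_zero_of_notMem_tsupport hx
        have hφ1' : fderiv ℝ φ (Fin.init w) = 0 := fderiv_of_notMem_tsupport ℝ hx
        rw [hφ0', hφ1']
        simp only [mul_zero, zero_mul, add_zero, zero_apply, sub_zero, abs_zero]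
        exact mul_nonneg (mul_nonneg hε.le hC'0)
          (mul_nonneg (Set.indicator_nonneg (fun _ _ => zero_le_one) _) (hd0 _))
    -- integrate the pointwise bound
    have hFi : Integrable ((tsupport φ).indicator (1 : (Fin n → EuclideanSpace ℝ (Fin 3)) → ℝ)) := by
      rw [integrable_indicator_iff hK.measurableSet]
      exact integrableOn_const hK.measure_lt_top.ne
    have hGi : Integrable fun z : EuclideanSpace ℝ (Fin 3) => d (L⁻¹ • z) :=
      (integrable_comp_smul_iff volume d (inv_ne_zero hL0.ne')).2 hdi
    have hdom := (mtw_integrable_init_mul_last hFi hGi).const_mul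
      (ε * (‖b‖ * |Mφ| * |Mχ| + (|2 * Δ - 6| * (|M₃| * |Mχ| + ‖b‖ * Rχ * |Mφ| * |Mχ|) +
          |Mχ| * |M₂| + 3 * |M₁| * ‖b‖ * Rχ ^ 2 * |Mφ|)))
    have hInt := (abs_integral_le_integral_abs.trans
      (integral_mono_of_nonneg (ae_of_all _ fun w => abs_nonneg _) hdom (ae_of_all _ hpt)))
    rw [integral_const_mul, mtw_integral_init_mul_last n
      ((tsupport φ).indicator (1 : (Fin n → EuclideanSpace ℝ (Fin 3)) → ℝ)) (fun z => d (L⁻¹ • z)),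
      integral_indicator_one hK.measurableSet, integral_comp_inv_smul_three d hL0.le, ← hkey] at hInt
    rw [abs_mul, abs_mul, abs_mul, abs_of_pos (pow_pos hL0 3), abs_of_pos hχi] at hInt
    have hfin : |c| * (∫ z, χ z) * |∫ x, Sn x * ((2 * Δ - 6) * (∑ i, inner ℝ b (x i)) * φ x +
        fderiv ℝ φ x (fun i => ‖x i‖ ^ 2 • b - (2 * inner ℝ b (x i)) • x i))| * L ^ 3 ≤
        ε * ((‖b‖ * |Mφ| * |Mχ| + (|2 * Δ - 6| * (|M₃| * |Mχ| + ‖b‖ * Rχ * |Mφ| * |Mχ|) +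
          |Mχ| * |M₂| + 3 * |M₁| * ‖b‖ * Rχ ^ 2 * |Mφ|)) *
          (volume.real (tsupport φ) * ∫ z, d z)) * L ^ 3 := by
      calc _ = |c| * (L ^ 3 * ∫ z, χ z) * |∫ x, Sn x * ((2 * Δ - 6) * (∑ i, inner ℝ b (x i)) * φ x +
            fderiv ℝ φ x (fun i => ‖x i‖ ^ 2 • b - (2 * inner ℝ b (x i)) • x i))| := by ring
        _ ≤ _ := hInt
        _ = _ := by ring
    exact le_of_mul_le_mul_right hfin (pow_pos hL0 3)
  -- conclusion: `|c| (∫χ) |W| ≤ 0`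
  have h0 : |c| * (∫ z, χ z) * |∫ x, Sn x * ((2 * Δ - 6) * (∑ i, inner ℝ b (x i)) * φ x +
      fderiv ℝ φ x (fun i => ‖x i‖ ^ 2 • b - (2 * inner ℝ b (x i)) • x i))| ≤ 0 := by
    refine le_of_forall_pos_lt_add fun ε hε => ?_
    set C := (‖b‖ * |Mφ| * |Mχ| + (|2 * Δ - 6| * (|M₃| * |Mχ| + ‖b‖ * Rχ * |Mφ| * |Mχ|) +
      |Mχ| * |M₂| + 3 * |M₁| * ‖b‖ * Rχ ^ 2 * |Mφ|)) * (volume.real (tsupport φ) * ∫ z, d z) with hC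
    have hC0 : 0 ≤ C := by positivity
    have h := hmain (ε / (C + 1)) (by positivity)
    calc _ ≤ ε / (C + 1) * C := h
      _ < 0 + ε := by
          rw [zero_add, div_mul_eq_mul_div, div_lt_iff₀ (by positivity)]
          nlinarith
  have hpos : 0 < |c| * ∫ z, χ z := mul_pos (abs_pos.2 hc) hχi
  have habs : |∫ x, Sn x * ((2 * Δ - 6) * (∑ i, inner ℝ b (x i)) * φ x +
      fderiv ℝ φ x (fun i => ‖x i‖ ^ 2 • b - (2 * inner ℝ b (x i)) • x i))| ≤ 0 := by
    by_contra hne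
    have := mul_pos hpos (not_le.1 hne)
    linarith
  exact abs_nonpos_iff.1 habs

/-! ## The registered stub -/

/-- **Stub S5b (`stub_multipoleToWardOfContinuous`) — item 5356 with continuous far-field
coefficients.** First-multipole identity at level `n+1` + monopole/dipole clustering at level `n`,
for CONTINUOUS coefficients `A₀, A₁`, imply the weak special-conformal Ward identity with weight `Δ`
for `S n`: `∫ Sₙ [(2Δ−6)(Σᵢ⟪b,xᵢ⟫) φ + Dφ(x)[(‖xᵢ‖²b − 2⟪b,xᵢ⟫xᵢ)ᵢ]] = 0`.
[FrancescoMathieuSenechal1997 §4.2–4.3; HormanderALPDO1 §1] -/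
theorem stub_multipoleToWardOfContinuous :
    ∀ (S : CorrFamily 3) (c Δ : ℝ), c ≠ 0 → (∀ n, ContinuousOn (S n) (NonCoincident 3 n)) →
      (∀ n : ℕ, ∃ (A₀ : (Fin (n + 1) → EuclideanSpace ℝ (Fin 3)) → ℝ)
          (A₁ : (Fin (n + 1) → EuclideanSpace ℝ (Fin 3)) → EuclideanSpace ℝ (Fin 3)),
        ContinuousOn A₀ (NonCoincident 3 (n + 1)) ∧ ContinuousOn A₁ (NonCoincident 3 (n + 1)) ∧
        (∀ (b : EuclideanSpace ℝ (Fin 3)) (ψ : (Fin (n + 1) → EuclideanSpace ℝ (Fin 3)) → ℝ),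
          ContDiff ℝ ((⊤ : ℕ∞) : WithTop ℕ∞) ψ → HasCompactSupport ψ → tsupport ψ ⊆ NonCoincident 3 (n + 1) →
          ∫ w, inner ℝ (A₁ w) b * ψ w =
            ∫ w, A₀ w * ((2 * Δ - 6) * (∑ i, inner ℝ b (w i)) * ψ w +
              fderiv ℝ ψ w (fun i => ‖w i‖ ^ 2 • b - (2 * inner ℝ b (w i)) • w i))) ∧
        TendstoLocallyUniformlyOn
          (fun (z : EuclideanSpace ℝ (Fin 3)) (x : Fin n → EuclideanSpace ℝ (Fin 3)) =>
            ‖z‖ * (A₀ (Fin.snoc x z) - c * S n x))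
          0 (Filter.cocompact (EuclideanSpace ℝ (Fin 3))) (NonCoincident 3 n) ∧
        TendstoLocallyUniformlyOn
          (fun (z : EuclideanSpace ℝ (Fin 3)) (x : Fin n → EuclideanSpace ℝ (Fin 3)) =>
            A₁ (Fin.snoc x z) - (2 * Δ * c * S n x) • z)
          0 (Filter.cocompact (EuclideanSpace ℝ (Fin 3))) (NonCoincident 3 n)) →
      ∀ (n : ℕ) (b : EuclideanSpace ℝ (Fin 3)) (φ : (Fin n → EuclideanSpace ℝ (Fin 3)) → ℝ),
        ContDiff ℝ ((⊤ : ℕ∞) : WithTop ℕ∞) φ → HasCompactSupport φ → tsupport φ ⊆ NonCoincident 3 n →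
        ∫ x, S n x * ((2 * Δ - 6) * (∑ i, inner ℝ b (x i)) * φ x +
          fderiv ℝ φ x (fun i => ‖x i‖ ^ 2 • b - (2 * inner ℝ b (x i)) • x i)) = 0 := by
  intro S c Δ hc hcont hFF n b φ hφ hφc hφs
  obtain ⟨A₀, A₁, hA₀, hA₁, hI, hM, hD⟩ := hFF n
  refine mtw_ward_of_farField b Δ c (S n) A₀ A₁ φ hc (hcont n) hA₀ hA₁ hφ hφc hφs
    (fun ψ h1 h2 h3 => hI b ψ h1 h2 h3) fun ε hε => ?_
  obtain ⟨R₀, hR₀⟩ := exists_radius_of_tendstoLocallyUniformlyOn hM hφc hφs hε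
  obtain ⟨R₁, hR₁⟩ := exists_radius_of_tendstoLocallyUniformlyOn hD hφc hφs hε
  refine ⟨max R₀ R₁, fun z hz x hx => ⟨?_, ?_⟩⟩
  · exact hR₀ z ((le_max_left _ _).trans hz) x hx
  · exact hR₁ z ((le_max_right _ _).trans hz) x hx

end Summit.CriticalPhenomena.Ising3DConformalLimit.PrecisionLaplacianMoebiusLimitOfTwoPointLaw
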